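import Summits.BirchSwinnertonDyer.BirchSwinnertonDyer.Theorems.PrintCf2RubinValueTwoCMDivisionTowerScalars
import Summits.BirchSwinnertonDyer.BirchSwinnertonDyer.Theorems.PrintCf2RubinValueTwoCClassUpsilonGoodFrame
import Summits.BirchSwinnertonDyer.BirchSwinnertonDyer.Theorems.PrintCf2RubinValueTwoFrameSeedDyadicEmbedding
import Summits.BirchSwinnertonDyer.BirchSwinnertonDyer.Theorems.PrintCf2SplitBadTwoHPrimeBookkeeping
import Literature.NumberTheory.EllipticCurves.ComplexMultiplicationDeuringGaloisActionProofs
import Literature.NumberTheory.EllipticCurves.WeilPairingCyclicComponentsDeterminantProofs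
import Literature.NumberTheory.Automorphic.GaloisActionPlaces
import Literature.NumberTheory.GaloisRepresentations.LAdicAlgPartSplitPrime
import Literature.NumberTheory.ComplexMultiplication.EllipticUnits.ImaginaryQuadraticMainConjectureClassGroupRowLayers
import Literature.NumberTheory.QuadraticFields.HeegnerCondition
import Literature.NumberTheory.EllipticCurves.Agboola2007.RestrictedSelmerGroups
import Summits.BirchSwinnertonDyer.BirchSwinnertonDyer.Theorems.PrintCf2RubinValueTwoTwistedLayerConjRealise
import Summits.BirchSwinnertonDyer.BirchSwinnertonDyer.Theorems.PrintCf2SplitBadTwoAdditiveAtSeven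
import HarnessLib

/-!
# Division-tower alignment, file 4: THE DA7 FRAME SUPPLIES THE CORE'S «GOOD FRAME» HYPOTHESES — the conjugation `c` with
# `c • v = v̄`, `ord_v 2 = ord_v̄ 2 = 1`, the dyadic embeddings behind `ι⁻¹∘σ_w` and `ι⁻¹∘σ̄_w`, inertia at `v` fixes `E[v̄^∞]`,
# and BIGNESS: `χ_cyc(γ₁) ≢ 1 (mod 8)` (local Artin symbol of `5` at `K_v = ℚ₂` + the `ℤ₂²`-decomposition), so `γ₁` acts
# on `E[v^∞]` through `χ_cyc(γ₁) ≡ 5 (mod 8)` (Weil pairing)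

Cell `bsd-print-cf2`, width seat `bsd-line-cf2-p1-w8` g7; `--supports` stmt-BirchSwinnertonDyer-23300 (helper).  Fourth file of the
DIVISION-TOWER ALIGNMENT residual (T-a)–(T-d) of LEAD's v2.6 `stub_towerDescentT1` (hypotheses of -w7 g9's p736536); it discharges, on the
DA7 frame of the class door (`K` imaginary quadratic, `d_K = −7`, `2 = v v̄`, a top generator pair with `κ₂` unramified outside `v̄`, `κ₁`
outside `v`, `γᵢ` in the inertia groups and fixing `√−1`), the displayed hypotheses (H1)–(H4) of file 3's core
(`…CMDivisionTowerGalois`); (H5)–(H6) and the assembly are files 5–6.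

* §1 frame arithmetic: `exists_algEquiv_ne_one_smul_eq` (`c ≠ 1` with `c • v = v̄`, Galois transitivity
  `Automorphic.HeightOneSpectrum.exists_algEquiv_smul_eq`), `intValuation_two_eq_of_ne` (`ord_w 2 = 1` at both places, degree-one lemma
  `LocalField.ramificationIdx_eq_one_and_inertiaDeg_eq_one_of_ne`), `exists_intEmb_of_discr` / `mem_iff_two_dvd_comp_symm` (cruxlead-23721's
  `FrameSeed.exists_intEmb` behind any `K → ℚ̄₂`, and the place `v̄` of `φ₀ ∘ c⁻¹`), `embedding_comp_symm_eq_conjugate`.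
* §2 ★ `toZModPow_three_cyclotomicCharacter_ne_one` — **`χ_cyc(γ₁) ≢ 1 (mod 8)`**: a Weil inertia element `w` at `v` with local Artin
  symbol `5` restricts to `τ ∈ I_v` with `χ_cyc(τ) = N(5) = 5` (tree: `isLocalArtinMap_canonicalArtin_holds`,
  `cyclotomicCharacter_toAbsGalois_eq_norm_canonicalArtin`, -w8 g6's F2′ template), `κ₂(τ) = 0`; writing `τ ≡ γ₁^a γ₂^b` modulo a deep
  layer (`b ≡ 0`), `χ_cyc ≡ ±1 (mod 8)` on deep layers (-w8 g6 `HPrime.cyclotomicCharacter_eq_one_or_eq_neg_one_of_mem_pairKer` + JLK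
  `ClassGroupRow.exists_pairLayerSubgroup_subset`) and `χ_cyc(γ₂) ≡ 1 (mod 4)` give `χ_cyc(γ₁)^a ≡ ±5`, impossible if `χ_cyc(γ₁) ≡ 1 (8)`.
* §3 Deuring components in the frame: `smul_eq_self_of_mem_inertia` (`I_v` fixes `E[v̄^∞]`, Deuring (inert) + `ψ_E` unramified at `v`),
  ★ `intCast_eq_toZModPow_cyclotomicCharacter_of_fix` (if `σ` fixes `g_{v̄}^{(j)}` then its scalar on `g_v^{(j)}` is `χ_cyc(σ) (mod 2^j)`, Weil
  `intCast_mul_eq_toZModPow_cyclotomicCharacter_of_cyclic_layers`).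

THEOREMS ONLY (no `def`, no named fact, no `sorry`); Theses-free.  HONEST FRAMING: bookkeeping over tree theorems; closes nothing; beyond-print
theorem: no.  No summit statement is proved by this seat; BSD is not proved by any of this.

References: [Rubin1999] K. Rubin, LNM 1716 (1999), §5 Thm. 5.15, Cor. 5.16; [SerreLocalFields1979] J.-P. Serre, *Local Fields*, XIII §4,
XIV §7 (local Artin map, inertia ↠ units); [SilvermanAEC2009] III.8.1 (Weil pairing); [Washington1997] §13.1; [NeukirchANT1999] I §8 (8.2).
-/

-- the summit namespace `Summit.BirchSwinnertonDyer.BirchSwinnertonDyer` repeats the problem name by design (D-0017)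
set_option linter.dupNamespace false
set_option autoImplicit false

noncomputable section

open scoped Classical

open Field NumberField IsDedekindDomain WeierstrassCurve Literature.NumberTheory.EllipticCurves
  Literature.NumberTheory.EllipticCurves.DeuringGaloisAction Literature.NumberTheory.GaloisRepresentations
  Literature.NumberTheory.ComplexMultiplication.EllipticUnits
  Literature.NumberTheory.EllipticCurves.WeilPairingCyclicComponents
open Summit.BirchSwinnertonDyer.BirchSwinnertonDyer.Theorems.PrintCf2.HPrime (cyclotomicCharacter_eq_one_or_eq_neg_one_of_mem_pairKer)
open Summit.BirchSwinnertonDyer.BirchSwinnertonDyer.Theorems.PrintCf2.TwistedZeta (exists_pow_mul_pow_mul_inv_mem_pairLayerSubgroup)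

namespace Summit.BirchSwinnertonDyer.BirchSwinnertonDyer.Theorems.PrintCf2.CMDivisionTower

variable {K : Type} [Field K] [NumberField K]

/-! ## §1. Frame arithmetic: `c • v = v̄`, `ord 2 = 1`, the dyadic embeddings -/

/-- **The non-trivial automorphism swaps the two places above `2`**: `K` imaginary quadratic, `2 = v v̄` with `v̄ ≠ v`: there is
`c : K ≃ₐ[ℚ] K` with `c ≠ 1` and `c • v = v̄` (transitivity of `Gal(K/ℚ)` on the primes above `(2)`). [cite: NeukirchANT1999, Ch. I §9 (9.1)] -/
theorem exists_algEquiv_ne_one_smul_eq (hK : IsImaginaryQuadratic K) {v vbar : HeightOneSpectrum (𝓞 K)}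
    (hv : ((2 : ℕ) : 𝓞 K) ∈ v.asIdeal) (hvbar : ((2 : ℕ) : 𝓞 K) ∈ vbar.asIdeal) (hne : vbar ≠ v) :
    ∃ c : K ≃ₐ[ℚ] K, c ≠ 1 ∧ c • v = vbar := by
  haveI : Algebra.IsQuadraticExtension ℚ K := ⟨hK.1⟩
  haveI : Fact (Nat.Prime 2) := ⟨Nat.prime_two⟩
  have hunder : v.under (𝓞 ℚ) = vbar.under (𝓞 ℚ) :=
    LocalField.heightOneSpectrum_rat_eq_of_natCast_mem 2 _ _ (LocalField.natCast_mem_under 2 v hv)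
      (LocalField.natCast_mem_under 2 vbar hvbar)
  obtain ⟨c, hc⟩ := Literature.NumberTheory.Automorphic.HeightOneSpectrum.exists_algEquiv_smul_eq (F := ℚ) hunder
  refine ⟨c, fun h1 ↦ hne ?_, hc⟩
  rw [← hc, h1, one_smul]

/-- **`ord_w 2 = 1` at each of two distinct places above `2` of a quadratic field** (`e(w∣2) = 1` from the fundamental identity,
`LocalField.ramificationIdx_eq_one_and_inertiaDeg_eq_one_of_ne`; then `|2|_w = |2|_2^e`). [cite: NeukirchANT1999, Ch. I §8 Prop. (8.2)] -/
theorem intValuation_two_eq_of_ne (hK : IsImaginaryQuadratic K) {v vbar : HeightOneSpectrum (𝓞 K)}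
    (hv : ((2 : ℕ) : 𝓞 K) ∈ v.asIdeal) (hvbar : ((2 : ℕ) : 𝓞 K) ∈ vbar.asIdeal) (hne : vbar ≠ v) :
    v.intValuation (2 : 𝓞 K) = WithZero.exp (-1 : ℤ) := by
  haveI : Algebra.IsQuadraticExtension ℚ K := ⟨hK.1⟩
  haveI : Fact (Nat.Prime 2) := ⟨Nat.prime_two⟩
  have he := (LocalField.ramificationIdx_eq_one_and_inertiaDeg_eq_one_of_ne 2 v vbar hne.symm hv hvbar).1.1
  have h2u : ((2 : ℕ) : 𝓞 ℚ) ∈ (v.under (𝓞 ℚ)).asIdeal := LocalField.natCast_mem_under 2 v hv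
  have hgen : Rat.HeightOneSpectrum.natGenerator (v.under (𝓞 ℚ)) = 2 := LocalField.natGenerator_eq_of_natCast_mem 2 _ h2u
  have hval := AdditiveAtSeven.valuation_algebraMap_eq_pow_ramificationIdx K v (2 : ℚ)
  rw [he, pow_one] at hval
  have hnat : (v.under (𝓞 ℚ)).valuation ℚ (2 : ℚ) = WithZero.exp (-1 : ℤ) := by
    have := Rat.valuation_natGenerator (v.under (𝓞 ℚ))
    rwa [hgen, Nat.cast_ofNat] at this
  rw [hnat, map_ofNat] at hval
  rw [← hval, show (2 : K) = algebraMap (𝓞 K) K 2 by rw [map_ofNat], HeightOneSpectrum.valuation_of_algebraMap]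

/-- **The dyadic embedding behind any `φ : K → ℚ̄₂` for `d_K = −7`** (cruxlead-23721 `FrameSeed.exists_intEmb`, with `√−7 ∈ K` from
`Quadratic.exists_sq_eq_discr`): `φ₀ : 𝓞 K →+* ℤ₂` with `φ₀ k = φ k` in `ℚ̄₂`. [cite: Serre1973, Ch. II §3.3] [cite: SerreAbelianLadic1968, Ch. II §2.7] -/
theorem exists_intEmb_of_discr (hK : IsImaginaryQuadratic K) (hdK : NumberField.discr K = -7) (φ : K →+* PadicAlgCl 2) :
    ∃ φ₀ : 𝓞 K →+* ℤ_[2], ∀ k : 𝓞 K, algebraMap ℚ_[2] (PadicAlgCl 2) ((φ₀ k : ℤ_[2]) : ℚ_[2]) = φ (k : K) := by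
  obtain ⟨-, -, δ, -, hδ⟩ := Literature.NumberTheory.QuadraticFields.Quadratic.exists_sq_eq_discr (K := K) hK.1
  have hθ : ((δ : 𝓞 K) : K) ^ 2 = -7 := by
    have h := congrArg ((↑) : 𝓞 K → K) hδ
    push_cast at h
    rw [h, hdK]; norm_num [map_ofNat]
  exact FrameSeed.exists_intEmb hK.1 hθ φ

/-- **A twisted complex embedding is the conjugate one**: for `c ≠ 1` and the (complex) infinite place `w` of the imaginary quadratic `K`,
`σ_w ∘ c⁻¹ = σ̄_w`. [cite: Weil1956, §1] -/
theorem embedding_comp_symm_eq_conjugate (hK : IsImaginaryQuadratic K) (w : InfinitePlace K) {c : K ≃ₐ[ℚ] K} (hc : c ≠ 1) :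
    w.embedding.comp (c.symm : K →+* K) = ComplexEmbedding.conjugate w.embedding := by
  haveI : IsTotallyComplex K := hK.2
  rcases PadicEmbedding.embedding_eq_or_eq_conjugate hK.1 (IsTotallyComplex.isComplex w) (w.embedding.comp (c.symm : K →+* K))
    with h | h
  · exfalso
    apply hc
    have h1 : ∀ y : K, c.symm y = y := fun y ↦ w.embedding.injective (by simpa using RingHom.congr_fun h y)
    ext x
    have h2 := h1 (c x)
    rw [AlgEquiv.symm_apply_apply] at h2
    rw [AlgEquiv.one_apply]
    exact h2.symm
  · exact h

/-- **The place of `φ₀ ∘ c⁻¹` is `v̄`**: if `φ₀` detects `v` (`k ∈ v ↔ 2 ∣ φ₀ k`) and `c • v = v̄`, then `k ∈ v̄ ↔ 2 ∣ φ₀ (c⁻¹ k)`.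
[cite: NeukirchANT1999, Ch. I §9 (9.1)] -/
theorem mem_iff_two_dvd_comp_symm {v vbar : HeightOneSpectrum (𝓞 K)} {c : K ≃ₐ[ℚ] K} (hc : c • v = vbar) {φ₀ : 𝓞 K →+* ℤ_[2]}
    (hφv : ∀ k : 𝓞 K, k ∈ v.asIdeal ↔ (2 : ℤ_[2]) ∣ φ₀ k) (k : 𝓞 K) :
    k ∈ vbar.asIdeal ↔ (2 : ℤ_[2]) ∣ φ₀ (c⁻¹ • k) := by
  rw [← hφv, ← hc, ← Literature.NumberTheory.Automorphic.HeightOneSpectrum.smul_mem_smul_asIdeal_iff c v (c⁻¹ • k), smul_inv_smul]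

/-! ## §2. BIGNESS: `χ_cyc(γ₁) ≢ 1 (mod 8)` -/

/-- **`χ_cyc ≡ ±1 (mod 8)` on deep layers of the `ℤ₂²`-tower** (`K` imaginary quadratic, any top generator pair): some
`Gal(K̄/K̃_N)` lies in `{σ : χ_cyc(σ) mod 8 ∈ {±1}}` (an open set containing `Gal(K̄/K̃_∞)`, on which `χ_cyc = ±1`).
[cite: Washington1997, §13.1] [cite: Serre1968, Ch. I §1.2] -/
theorem exists_forall_toZModPow_three_cyclotomicCharacter_of_mem_pairLayerSubgroup (hK : IsImaginaryQuadratic K)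
    {κ₁ κ₂ : ZpExtension K 2} {γ₁ γ₂ : absoluteGaloisGroup K} (hγ : ZpExtension.IsTopGeneratorPair κ₁ κ₂ γ₁ γ₂) :
    ∃ N : ℕ, ∀ σ ∈ pairLayerSubgroup κ₁ κ₂ N,
      PadicInt.toZModPow 3 ((GaloisRep.cyclotomicCharacter K 2 σ : ℤ_[2]ˣ) : ℤ_[2]) = 1 ∨
        PadicInt.toZModPow 3 ((GaloisRep.cyclotomicCharacter K 2 σ : ℤ_[2]ˣ) : ℤ_[2]) = -1 := by
  set f : absoluteGaloisGroup K → ZMod (2 ^ 3) := fun σ ↦ PadicInt.toZModPow 3 ((GaloisRep.cyclotomicCharacter K 2 σ : ℤ_[2]ˣ) : ℤ_[2])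
    with hf
  have hfc : Continuous f := (OneUnits.continuous_toZModPow 2 3).comp
    (Units.continuous_val.comp (GaloisRep.cyclotomicCharacter K 2).continuous)
  have hopen : IsOpen (f ⁻¹' {1, -1}) := (isOpen_discrete _).preimage hfc
  have hsub : (ZpExtension.pairKer κ₁ κ₂ : Set (absoluteGaloisGroup K)) ⊆ f ⁻¹' {1, -1} := by
    intro σ hσ
    rcases cyclotomicCharacter_eq_one_or_eq_neg_one_of_mem_pairKer hK hγ hσ with h | h
    · left; simp only [hf, h, Units.val_one, map_one]
    · right; simp only [hf, h, Units.val_neg, Units.val_one, map_neg, map_one, Set.mem_singleton_iff]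
  obtain ⟨N, hN⟩ := JohnsonLeungKings2011.ClassGroupRow.exists_pairLayerSubgroup_subset 2 κ₁ κ₂ hopen hsub
  exact ⟨N, fun σ hσ ↦ by simpa [hf] using hN hσ⟩

/-- **An inertia element at `v ∣ 2` (`K_v = ℚ₂`) with local Artin symbol `5`**: `K` imaginary quadratic, `2 = v v̄`; some
`τ ∈ GreenbergSelmer.inertia v` has `χ_cyc(τ) = 5` (`χ_cyc(res_v w) = N_{K_v/ℚ₂}(a_v w)`, -w8 g6's F2′ template with `5` for `−1`).
[cite: SerreLocalFields1979, Ch. XIII §4 Thm. 2, Ch. XIV §7] [cite: NeukirchANT1999, Ch. VI §5 Prop. (5.6)] -/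
theorem exists_mem_inertia_cyclotomicCharacter_eq_five (hK : IsImaginaryQuadratic K) {v vbar : HeightOneSpectrum (𝓞 K)}
    (hv : ((2 : ℕ) : 𝓞 K) ∈ v.asIdeal) (hvbar : ((2 : ℕ) : 𝓞 K) ∈ vbar.asIdeal) (hne : vbar ≠ v) :
    ∃ τ ∈ GreenbergSelmer.inertia v, (((GaloisRep.cyclotomicCharacter K 2 τ : ℤ_[2]ˣ) : ℤ_[2]) : ℚ_[2]) = 5 := by
  haveI : CharZero (v.adicCompletion K) := LocalField.charZero_adicCompletion v
  have ha := isLocalArtinMap_canonicalArtin_holds (v.adicCompletion K)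
  have hℓ := LocalField.valuation_adicCompletion_natCast_lt_one v 2 hv
  -- `5 = 1 + 2·2` is a unit of `K_v`
  have h5 : ValuativeRel.valuation (v.adicCompletion K) (5 : v.adicCompletion K) = 1 := by
    rw [show (5 : v.adicCompletion K) = 1 + (2 : ℕ) * (2 : ℕ) by norm_num]
    refine Valuation.map_one_add_of_lt _ ?_
    rw [Valuation.map_mul]
    exact mul_lt_one_of_nonneg_of_lt_one_left zero_le hℓ hℓ.le
  have h50 : (5 : v.adicCompletion K) ≠ 0 := by
    intro h; rw [h, Valuation.map_zero] at h5; exact zero_ne_one h5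
  have hmem : (Units.mk0 (5 : v.adicCompletion K) h50) ∈ (ValuativeRel.valuation (v.adicCompletion K)).valuationSubring.unitGroup := by
    rw [Valuation.mem_unitGroup_iff, Units.val_mk0]; exact h5
  rw [← ha.image_inertia] at hmem
  obtain ⟨w, hw, hart⟩ := Subgroup.mem_map.mp hmem
  refine ⟨absGaloisRestrict K (v.adicCompletion K) (WeilGroup.toAbsGalois (v.adicCompletion K) w),
    Subgroup.mem_map.mpr ⟨WeilGroup.toAbsGalois _ w, WeilGroup.mem_inertia_iff.mp hw, rfl⟩, ?_⟩
  haveI : Algebra.IsQuadraticExtension ℚ K := ⟨hK.1⟩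
  have hcyc := cyclotomicCharacter_toAbsGalois_eq_norm_canonicalArtin (ℓ := 2) (v.adicCompletion K) hℓ hw
  letI := LocalField.padicAlgebra (v.adicCompletion K) 2 hℓ
  have hbij := LocalField.bijective_algebraMap_adicCompletionPadicAlgebra_of_split (p := 2) v vbar hne.symm hv hvbar
  have hfin : Module.finrank ℚ_[2] (v.adicCompletion K) = 1 := by
    rw [← (LinearEquiv.ofBijective (Algebra.linearMap ℚ_[2] (v.adicCompletion K)) hbij).finrank_eq, Module.finrank_self]
  have hnorm : Algebra.norm ℚ_[2] (((canonicalArtin (v.adicCompletion K) w : (v.adicCompletion K)ˣ) : v.adicCompletion K)) = 5 := by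
    rw [hart, Units.val_mk0, show (5 : v.adicCompletion K) = algebraMap ℚ_[2] (v.adicCompletion K) 5 by rw [map_ofNat],
      Algebra.norm_algebraMap, hfin, pow_one]
  rw [hnorm] at hcyc
  haveI : NeZero ((2 : ℕ) : K) := ⟨by exact_mod_cast (two_ne_zero : (2 : K) ≠ 0)⟩
  rw [cyclotomicCharacter_absGaloisRestrict K (v.adicCompletion K) 2, hcyc]

/-- ★ **BIGNESS: `χ_cyc(γ₁) ≢ 1 (mod 8)`** on the frame (`K` imaginary quadratic, `2 = v v̄`, top generator pair `(κ₁, κ₂; γ₁, γ₂)` with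
`κ₂` unramified outside `v̄` and `γ₂` fixing `√−1`).  With `τ ∈ I_v`, `χ_cyc(τ) = 5`: `κ₂(τ) = 0`, so `γ₁^aγ₂^bτ⁻¹` is deep with `2^N ∣ b`;
then `χ_cyc(γ₂)^b ≡ 1`, the deep factor is `±1 (mod 8)`, whence `χ_cyc(γ₁)^a ≡ ±5 (mod 8)` — impossible if `χ_cyc(γ₁) ≡ 1 (mod 8)`.
[cite: SerreLocalFields1979, Ch. XIV §7] [cite: Washington1997, §13.1] [cite: Serre1973, Ch. II §3.2] -/
theorem toZModPow_three_cyclotomicCharacter_ne_one (hK : IsImaginaryQuadratic K) {v vbar : HeightOneSpectrum (𝓞 K)}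
    (hv : ((2 : ℕ) : 𝓞 K) ∈ v.asIdeal) (hvbar : ((2 : ℕ) : 𝓞 K) ∈ vbar.asIdeal) (hne : vbar ≠ v)
    {κ₁ κ₂ : ZpExtension K 2} {γ₁ γ₂ : absoluteGaloisGroup K} (hγ : ZpExtension.IsTopGeneratorPair κ₁ κ₂ γ₁ γ₂)
    (hκ₂ : κ₂.IsUnramifiedOutside vbar) (hμ₂ : ∀ i : AlgebraicClosure K, i ^ 2 = -1 → γ₂ • i = i) :
    PadicInt.toZModPow 3 ((GaloisRep.cyclotomicCharacter K 2 γ₁ : ℤ_[2]ˣ) : ℤ_[2]) ≠ 1 := by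
  intro h1
  obtain ⟨τ, hτI, hτ5⟩ := exists_mem_inertia_cyclotomicCharacter_eq_five hK hv hvbar hne
  obtain ⟨N₀, hN₀⟩ := exists_forall_toZModPow_three_cyclotomicCharacter_of_mem_pairLayerSubgroup hK hγ
  set N := max N₀ 1 with hN
  obtain ⟨a, b, hυ⟩ := exists_pow_mul_pow_mul_inv_mem_pairLayerSubgroup hγ τ N
  -- `2^N ∣ b` since `κ₂(τ) = 0`
  have hκ₂τ : κ₂ τ = 1 := hκ₂.apply_eq_one hne.symm hτI
  have hb : (2 : ℤ_[2]) ^ N ∣ (b : ℤ_[2]) := by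
    have h := (Subgroup.mem_inf.mp hυ).2
    rw [ZpExtension.mem_layerSubgroup, map_mul κ₂, map_mul κ₂, map_pow κ₂, map_pow κ₂, map_inv κ₂, hγ.apply_left, hκ₂τ,
      show κ₂ γ₂ = Multiplicative.ofAdd 1 from hγ.right, toAdd_mul, toAdd_mul, toAdd_inv, toAdd_pow, toAdd_pow, toAdd_ofAdd,
      toAdd_one, smul_zero, zero_add, neg_zero, add_zero, nsmul_eq_mul, mul_one] at h
    exact_mod_cast h
  -- `χ_cyc(γ₂) ≡ 1 (mod 4)`, hence `χ_cyc(γ₂)^b ≡ 1 (mod 8)` (as `2 ∣ b`)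
  obtain ⟨i, hi⟩ := IsAlgClosed.exists_pow_nat_eq (-1 : AlgebraicClosure K) two_pos
  have hγ₂4 : PadicInt.toZModPow 2 ((GaloisRep.cyclotomicCharacter K 2 γ₂ : ℤ_[2]ˣ) : ℤ_[2]) = 1 :=
    (FineSelmerUpstairs.smul_eq_self_iff_toZModPow_two_cyclotomicCharacter_eq_one i hi γ₂).mp (hμ₂ i hi)
  have h2b : 2 ∣ b := by
    have h21 : (2 : ℤ_[2]) ^ 1 ∣ (b : ℤ_[2]) := (pow_dvd_pow 2 (le_max_right N₀ 1)).trans hb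
    rw [pow_one] at h21
    have : ((b : ℤ) : ℤ_[2]) ∈ Ideal.span {(2 : ℤ_[2]) ^ 1} := by rw [pow_one, Ideal.mem_span_singleton, Int.cast_natCast]; exact h21
    have h' := (PadicInt.norm_int_le_pow_iff_dvd (k := (b : ℤ)) (n := 1)).mp ((PadicInt.norm_le_pow_iff_mem_span_pow _ 1).mpr this)
    exact Int.natCast_dvd_natCast.mp (by simpa using h')
  -- work in `ℤ/8`: `x := χ(γ₁)`, `y := χ(γ₂)`, `t := χ(τ) = 5`, `u := χ(deep)` with `x^a y^b t⁻¹ = u`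
  have hdeep := hN₀ _ (show γ₁ ^ a * γ₂ ^ b * τ⁻¹ ∈ pairLayerSubgroup κ₁ κ₂ N₀ from
    (inf_le_inf (κ₁.layerSubgroup_antitone (le_max_left N₀ 1)) (κ₂.layerSubgroup_antitone (le_max_left N₀ 1))) hυ)
  have hmap : PadicInt.toZModPow 3 ((GaloisRep.cyclotomicCharacter K 2 (γ₁ ^ a * γ₂ ^ b * τ⁻¹) : ℤ_[2]ˣ) : ℤ_[2]) =
      PadicInt.toZModPow 3 ((GaloisRep.cyclotomicCharacter K 2 γ₁ : ℤ_[2]ˣ) : ℤ_[2]) ^ a * PadicInt.toZModPow 3 ((GaloisRep.cyclotomicCharacter K 2 γ₂ : ℤ_[2]ˣ) : ℤ_[2]) ^ b *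
        PadicInt.toZModPow 3 (((GaloisRep.cyclotomicCharacter K 2 τ)⁻¹ : ℤ_[2]ˣ) : ℤ_[2]) := by
    simp only [map_mul, map_pow, map_inv, Units.val_mul, Units.val_pow_eq_pow_val]
  -- `χ(τ) ≡ 5`, so `χ(τ)⁻¹ ≡ 5 (mod 8)`
  have hτ8 : PadicInt.toZModPow 3 ((GaloisRep.cyclotomicCharacter K 2 τ : ℤ_[2]ˣ) : ℤ_[2]) = 5 := by
    have h : ((GaloisRep.cyclotomicCharacter K 2 τ : ℤ_[2]ˣ) : ℤ_[2]) = 5 := PadicInt.ext (by rw [hτ5]; norm_cast)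
    rw [h, map_ofNat]
  have hτinv8 : PadicInt.toZModPow 3 (((GaloisRep.cyclotomicCharacter K 2 τ)⁻¹ : ℤ_[2]ˣ) : ℤ_[2]) = 5 := by
    have hmul : PadicInt.toZModPow 3 ((GaloisRep.cyclotomicCharacter K 2 τ : ℤ_[2]ˣ) : ℤ_[2]) * PadicInt.toZModPow 3 (((GaloisRep.cyclotomicCharacter K 2 τ)⁻¹ : ℤ_[2]ˣ) : ℤ_[2]) = 1 := by
      rw [← map_mul, Units.mul_inv, map_one]
    rw [hτ8] at hmul
    have : (5 : ZMod (2 ^ 3)) * 5 = 1 := by decide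
    calc PadicInt.toZModPow 3 (((GaloisRep.cyclotomicCharacter K 2 τ)⁻¹ : ℤ_[2]ˣ) : ℤ_[2]) = 5 * 5 * PadicInt.toZModPow 3 (((GaloisRep.cyclotomicCharacter K 2 τ)⁻¹ : ℤ_[2]ˣ) : ℤ_[2]) := by
          rw [this, one_mul]
      _ = 5 := by rw [mul_assoc, hmul, mul_one]
  -- `χ(γ₂)^b ≡ 1 (mod 8)`: `y ≡ 1 (4)` gives `y² ≡ 1 (8)`
  have hy8 : PadicInt.toZModPow 3 ((GaloisRep.cyclotomicCharacter K 2 γ₂ : ℤ_[2]ˣ) : ℤ_[2]) ^ b = 1 := by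
    obtain ⟨b', rfl⟩ := h2b
    rw [pow_mul]
    have hy4 : ZMod.castHom (show 2 ^ 2 ∣ 2 ^ 3 by norm_num) (ZMod (2 ^ 2)) (PadicInt.toZModPow 3 ((GaloisRep.cyclotomicCharacter K 2 γ₂ : ℤ_[2]ˣ) : ℤ_[2])) = 1 := by
      rw [ZMod.castHom_apply, PadicInt.cast_toZModPow 2 3 (by norm_num), hγ₂4]
    have hsq : ∀ y : ZMod (2 ^ 3), ZMod.castHom (show 2 ^ 2 ∣ 2 ^ 3 by norm_num) (ZMod (2 ^ 2)) y = 1 → y ^ 2 = 1 := by decide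
    rw [hsq _ hy4, one_pow]
  rw [hmap, h1, one_pow, one_mul, hy8, one_mul, hτinv8] at hdeep
  exact absurd hdeep (by decide)

/-! ## §3. Deuring components in the frame: inertia, and the scalar of a «half-fixing» element -/

section Components

variable (W : WeierstrassCurve K) {ψ : HeckeCharacter K} {v vbar : HeightOneSpectrum (𝓞 K)}
  {Mv Mvbar : AddSubgroup (geomPrimaryTorsion W 2)}

/-- **`I_v` fixes `E[v̄^∞]` pointwise** when `ψ` is unramified at `v ≠ v̄` (Deuring (inert), the tree's
`IsPrimaryComponent.smul_eq_self_of_inertia_of_isUnramifiedAt`, with `GreenbergSelmer.inertia v = I_{𝔓₀}`).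
[cite: Rubin1999, §5 Thm. 5.15 (i)–(ii)] -/
theorem smul_eq_self_of_mem_inertia (hMvbar : IsPrimaryComponent W 2 ψ vbar Mvbar) (hne : vbar ≠ v) (hunr : ψ.IsUnramifiedAt v)
    {γ : absoluteGaloisGroup K} (hγ : γ ∈ GreenbergSelmer.inertia v) : ∀ x ∈ Mvbar, γ • x = x := by
  rw [show GreenbergSelmer.inertia v = (adicCompletionPrime K v).inertia (absoluteGaloisGroup K) from
    (inertia_adicCompletionPrime_eq_map_absInertia K v).symm] at hγ
  exact hMvbar.smul_eq_self_of_inertia_of_isUnramifiedAt hne.symm hunr (adicCompletionPrime_mem_primesAbove K v) hγ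

omit [NumberField K] in
/-- ★ **The scalar of an element fixing the other component is its cyclotomic character**: two complementary components with cyclic
layers `ℤ·g₁`, `ℤ·g₂` of order `2^j`; if `σ • g₂ = g₂` and `σ • g₁ = c • g₁` then `c ≡ χ_cyc(σ) (mod 2^j)` (Weil pairing:
`a₁a₂ ≡ χ_cyc`). [cite: SilvermanAEC2009, III.8.1] [cite: Rubin1999, §5 Prop. 5.4] -/
theorem intCast_eq_toZModPow_cyclotomicCharacter_of_fix [CharZero K] [W.IsElliptic] (hinf : Mv ⊓ Mvbar = ⊥) (hsup : Mv ⊔ Mvbar = ⊤)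
    {j : ℕ} {g₁ g₂ : geomPrimaryTorsion W 2} (hg₁ : Mv ⊓ AddSubgroup.torsionBy (geomPrimaryTorsion W 2) (2 ^ j) = AddSubgroup.zmultiples g₁)
    (hg₂ : Mvbar ⊓ AddSubgroup.torsionBy (geomPrimaryTorsion W 2) (2 ^ j) = AddSubgroup.zmultiples g₂) (hord₂ : addOrderOf g₂ = 2 ^ j)
    {σ : absoluteGaloisGroup K} {c : ℤ} (hc : σ • g₁ = c • g₁) (hfix : σ • g₂ = g₂) :
    (c : ZMod (2 ^ j)) = PadicInt.toZModPow j ((GaloisRep.cyclotomicCharacter K 2 σ : ℤ_[2]ˣ) : ℤ_[2]) := by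
  rcases Nat.eq_zero_or_pos j with rfl | hj
  · exact Subsingleton.elim (α := ZMod 1) _ _
  haveI : Fact (Nat.Prime 2) := ⟨Nat.prime_two⟩
  haveI : NeZero ((2 : ℕ) : K) := ⟨by exact_mod_cast (two_ne_zero : (2 : K) ≠ 0)⟩
  have h := intCast_mul_eq_toZModPow_cyclotomicCharacter_of_cyclic_layers W 2 Mv Mvbar hinf hsup hj.ne' hg₁ hg₂ hord₂ σ hc
    (a₂ := 1) (by rw [one_smul]; exact hfix)
  rwa [mul_one] at h

omit [NumberField K] in
/-- The same with the roles of the components swapped: `σ • g₁ = g₁`, `σ • g₂ = d • g₂` ⟹ `d ≡ χ_cyc(σ) (mod 2^j)`.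
[cite: SilvermanAEC2009, III.8.1] [cite: Rubin1999, §5 Prop. 5.4] -/
theorem intCast_eq_toZModPow_cyclotomicCharacter_of_fix' [CharZero K] [W.IsElliptic] (hinf : Mv ⊓ Mvbar = ⊥) (hsup : Mv ⊔ Mvbar = ⊤)
    {j : ℕ} {g₁ g₂ : geomPrimaryTorsion W 2} (hg₁ : Mv ⊓ AddSubgroup.torsionBy (geomPrimaryTorsion W 2) (2 ^ j) = AddSubgroup.zmultiples g₁)
    (hg₂ : Mvbar ⊓ AddSubgroup.torsionBy (geomPrimaryTorsion W 2) (2 ^ j) = AddSubgroup.zmultiples g₂) (hord₁ : addOrderOf g₁ = 2 ^ j)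
    {σ : absoluteGaloisGroup K} {d : ℤ} (hfix : σ • g₁ = g₁) (hd : σ • g₂ = d • g₂) :
    (d : ZMod (2 ^ j)) = PadicInt.toZModPow j ((GaloisRep.cyclotomicCharacter K 2 σ : ℤ_[2]ˣ) : ℤ_[2]) := by
  rw [inf_comm] at hinf
  rw [sup_comm] at hsup
  exact intCast_eq_toZModPow_cyclotomicCharacter_of_fix W hinf hsup hg₂ hg₁ hord₁ hd hfix

end Components

end Summit.BirchSwinnertonDyer.BirchSwinnertonDyer.Theorems.PrintCf2.CMDivisionTower

end
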